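import Summits.RiemannHypothesis.RiemannHypothesis.Theorems.OddSectorOddBartaFloorImagePositivity
import Summits.RiemannHypothesis.RiemannHypothesis.Theorems.OddSectorOddBartaFloorPhiRatio
import Summits.RiemannHypothesis.RiemannHypothesis.Theorems.OddSectorOddBartaFloorPhiOrigin
import Summits.RiemannHypothesis.RiemannHypothesis.Theorems.OddSectorOddBartaFloorPrimeLayerFloor
import HarnessLib

/-!
# Crux `OddSector.OddBartaFloor`, line `Sketch`: the supersolution inequality `T_a ≥ −e(a)H_a`

Assembly lemma `stub_asmFloor` of the lead's skeleton (crux item stmt-RiemannHypothesis-17779, route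
`RiemannHypothesis/OddSector`): there are `a₀` and `e → 0` such that for every window `a ≥ a₀` the
window image `T_a = 2ϖ_a sinh(t/2) + P_a + A_a` of the odd theta probe satisfies
`T_a(t) ≥ −e(a) H_a(t)` on `(0, a)` — the pointwise SUPERSOLUTION INEQUALITY of the 2001 programme
(results §§3–4, `A_aH_a = 𝒫 + S − D + 𝒜 ≥ −e(a)H_a`), here with `a₀` free and a soft `e`:
`ϖ_a ≥ 0` and `A_a ≥ 0` (`stub_imagePositivity`), `P_a ≥ e(a)Φ′ = −e(a)H_a` (`stub_primeLayerFloor`, fed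
by `stub_phiRatio` and `stub_phiOrigin`).
-/

set_option linter.dupNamespace false

noncomputable section

open Set MeasureTheory Filter
open scoped Real Topology

namespace Summit.RiemannHypothesis.RiemannHypothesis.Theorems.OddBartaFloor

open Literature.NumberTheory.LFunctions

/-- **The supersolution inequality** (assembly lemma `stub_asmFloor` of the skeleton): there are
`a₀` and `e → 0` with `T_a(t) ≥ −e(a)H_a(t)` for `a ≥ a₀`, `t ∈ (0, a)`. -/
theorem stub_asmFloor :
    ∃ a₀ : ℝ, ∃ e : ℝ → ℝ, Tendsto e atTop (𝓝 0) ∧ ∀ a : ℝ, a₀ ≤ a → ∀ t ∈ Ioo 0 a,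
      -(e a) * weilOddThetaVector a t ≤ oddThetaImage a t := by
  obtain ⟨a₀, e, he, hP⟩ := stub_primeLayerFloor stub_phiRatio stub_phiOrigin.1 stub_phiOrigin.2
  refine ⟨max a₀ 1, e, he, fun a ha t ht => ?_⟩
  have ha₀ : a₀ ≤ a := le_trans (le_max_left _ _) ha
  have ha1 : 0 < a := lt_of_lt_of_le one_pos (le_trans (le_max_right _ _) ha)
  obtain ⟨hpol, harch⟩ := stub_imagePositivity a ha1
  have h1 := hP a ha₀ t ht
  have h2 := harch t ht
  have h3 : 0 ≤ 2 * oddThetaPolarWeight a * Real.sinh (t / 2) :=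
    mul_nonneg (mul_nonneg zero_le_two hpol) (Real.sinh_nonneg_iff.2 (by linarith [ht.1]))
  have hH : weilOddThetaVector a t = -weilThetaPhiDeriv t :=
    weilOddThetaVector_of_mem ⟨by linarith [ht.1], ht.2.le⟩
  rw [oddThetaImage_def, hH]
  nlinarith

end Summit.RiemannHypothesis.RiemannHypothesis.Theorems.OddBartaFloor

end
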